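import Summits.BirchSwinnertonDyer.BirchSwinnertonDyer.Theorems.ResidualThetaTransportAtTwoRelativeLubinTateModule
import Literature.NumberTheory.EllipticCurves.FormalGroupNegProofs
import HarnessLib

/-!
# The formal group of a supersingular model with `a_p = 0` is RELATIVE LUBIN–TATE for `(π, q) = (−p, p²)`, III:
# ARBITRARY Lubin–Tate base `A` — a model `U/A` whose `i([p] X) ≡ X^{p²} (mod p)` is Lubin–Tate's `F_{i([p]X)}` and a formal
# `A`-module; any two such models are `A`-linearly isomorphic (the shape the CM partner `B/𝒪_{ℚ₄}` of a habitat curve enters in)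

Route `ResidualThetaTransportAtTwo` (RTT), crux (R≥)ᵖ `ResidualThetaCountLowerPureAtTwo` (stmt-BirchSwinnertonDyer-26074); seat
`prover-bsd-wall-rtt-p2` g9 (`--supports`, closes nothing); memo `Cruxes/ResidualThetaCountLowerPureAtTwo/RELATIVE-LT-g9.md` §2(b).
Sequel of `…RelativeLubinTateSeries` (p608987) / `…RelativeLubinTateModule`, which treat models `V ⊗ A` base-changed from `ℤ_p`.
HONEST FRAMING: THEOREMS ONLY (no definition, no named fact, no instance, no `sorry`); route-independent; pure formal-group algebra;
nothing about any Selmer group; BSD is not proved by any of this.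

WHY. In ROAD B (B3) of `RMC-ROADS-g6.md` the CM partner of a habitat curve `W` is a CM elliptic curve `B` over the Hilbert class field
`H` of `K = ℚ(√Δ_W)`, whose completion at `w ∣ 2` is `ℚ₄`; `B` is NOT defined over `ℤ₂`, so parts I–II (models `V ⊗ A` with `V/ℤ_p`) do
not literally apply to `B̂_w`. What singles out `B̂_w` is `[ψ_B(w)] = [−2]` lifting the `q = 4` Frobenius, i.e. `i_B([2] X) ≡ X⁴ (mod 2)`
(`RMC-LOCAL2-g7.md` §2 (b)). This file takes that congruence as the HYPOTHESIS on an arbitrary Weierstrass model `U` over an arbitrary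
Lubin–Tate base `A` for `(−p, p²)` and derives everything else, so that «`Ŵ ⊗ ℤ₄ ≅ B̂_w` as formal `ℤ₄`-modules» becomes
`formalGroupLaw_subst_compHom'` applied to `U = W ⊗ ℤ₄` (congruence from part I, `map_toZMod_formalNeg_subst_formalMul`) and `U' = B_w`
(congruence from CM) the day `B` is typed — with no further formal-group input.

WHAT (`U` a Weierstrass equation over a commutative ring; `f_U := U.formalNeg.subst (U.formalMul p) = i_U([p]_U X)`):
* §1 (EVERY commutative ring, by the universal equation `ℤ[aᵢ] ↪ ℚ[aᵢ]`): **`formalNeg_subst_formalMul_subst_formalGroupLaw'`**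
  (`[−n] ∘ F_U = F_U ∘ ([−n] × [−n])`), `formalMul_subst_formalNeg_subst_formalMul'` (`[m] ∘ [−n] = [−n] ∘ [m]`),
  `coeff_single_formalGroupLaw'` (`F_U ≡ X + Y (mod deg 2)`); bookkeeping `map_subst_formalGroupLaw_left/right`.
* §2 (`A` with `hA : IsLTRing (−p) (p²)`, `U/A` with `hU : p ∣ [Xⁿ] f_U − δ_{n,p²}` for all `n`): `isLTSeries_of_dvd` (`f_U ∈ 𝔉_{−p}`),
  **`formalGroupLaw_eq_ltF'`** (`F_U = LubinTate.ltF hA hf_U`), `formalGroupLaw_subst_hom'`, `hom_add_eq'`, `formalMul_eq_hom'`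
  (the formal `A`-module structure `[a]_U := LubinTate.hom hA hf hf a` is by endomorphisms of `F_U`, additive in `F_U`, extends `[n]_U`),
  and for two such models `U, U'`: **`formalGroupLaw_subst_compHom'`** (`[1]_{f_{U'},f_U} : F_U → F_{U'}` is a homomorphism; it is
  `A`-linear and invertible by part II's `compHom_subst_hom`).
* §3 consistency: for `V/ℤ_p` with `tr(V mod p) = 0`, the base change `U = V ⊗ A` satisfies `hU` (`dvd_coeff_map_of_padicInt`).

References: [LubinTate1965] §1 Lemma 1, Thm. 1; [Kobayashi2003] Thm. 8.4, Prop. 8.6; [deShalit1987] Ch. I §1.1–1.3, Ch. II §1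
(formal groups of CM curves at inert primes are Lubin–Tate for `ψ(𝔭)`); [SilvermanAEC2009] IV.2.
-/

set_option autoImplicit false
-- the Theorems namespace of this sub repeats the summit name by design (D-0017 nested layout)
set_option linter.dupNamespace false

noncomputable section

open scoped Classical
open PowerSeries WeierstrassCurve Literature.NumberTheory.EllipticCurves
  Literature.NumberTheory.GaloisRepresentations

namespace Summit.BirchSwinnertonDyer.BirchSwinnertonDyer.Theorems.RelativeLubinTate

/-! ## §1 `[−n]` is an endomorphism of `F_U` over every commutative ring -/

section AnyRing

variable {R S : Type*} [CommRing R] [CommRing S] (U : WeierstrassCurve R)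

/-- Base change of `θ ∘ F_U` for a series `θ` without constant term. [folklore] -/
theorem map_subst_formalGroupLaw_left (φ : R →+* S) {θ : R⟦X⟧} (hθ : constantCoeff θ = 0) :
    MvPowerSeries.map φ (PowerSeries.subst U.formalGroupLaw θ) =
      PowerSeries.subst (U.map φ).formalGroupLaw (PowerSeries.map φ θ) := by
  have hF : HasSubst U.formalGroupLaw := HasSubst.of_constantCoeff_zero U.constantCoeff_formalGroupLaw
  have _ := hθ
  rw [map_subst hF, map_formalGroupLaw]

/-- Base change of `F_U ∘ (θ × θ)` for a series `θ` without constant term. [folklore] -/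
theorem map_subst_formalGroupLaw_right (φ : R →+* S) {θ : R⟦X⟧} (hθ : constantCoeff θ = 0) :
    MvPowerSeries.map φ (MvPowerSeries.subst
        (fun i : Fin 2 ↦ PowerSeries.subst (MvPowerSeries.X i : MvPowerSeries (Fin 2) R) θ) U.formalGroupLaw) =
      MvPowerSeries.subst (fun i : Fin 2 ↦ PowerSeries.subst (MvPowerSeries.X i : MvPowerSeries (Fin 2) S)
        (PowerSeries.map φ θ)) (U.map φ).formalGroupLaw := by
  have hb0 : ∀ i : Fin 2, MvPowerSeries.constantCoeff
      (PowerSeries.subst (MvPowerSeries.X i : MvPowerSeries (Fin 2) R) θ) = 0 :=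
    fun i ↦ constantCoeff_subst_eq_zero (MvPowerSeries.constantCoeff_X i) _ hθ
  have hbs : MvPowerSeries.HasSubst
      (fun i : Fin 2 ↦ PowerSeries.subst (MvPowerSeries.X i : MvPowerSeries (Fin 2) R) θ) :=
    MvPowerSeries.hasSubst_of_constantCoeff_zero hb0
  rw [MvPowerSeries.map_subst hbs, map_formalGroupLaw]
  congr 1
  funext i
  rw [map_subst (HasSubst.X i), MvPowerSeries.map_X]

/-- `i_U([n] X)` has no constant term (any ring). [folklore] -/
theorem constantCoeff_formalNeg_subst_formalMul' (n : ℕ) :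
    constantCoeff (U.formalNeg.subst (U.formalMul n)) = 0 :=
  constantCoeff_subst_eq_zero (U.constantCoeff_formalMul n) _ U.constantCoeff_formalNeg

/-- Base change of `i_U([n] X)` along any ring map (any ring). [folklore] -/
theorem map_formalNeg_subst_formalMul' (φ : R →+* S) (n : ℕ) :
    PowerSeries.map φ (U.formalNeg.subst (U.formalMul n)) = (U.map φ).formalNeg.subst ((U.map φ).formalMul n) := by
  rw [powerSeries_map_subst _ (HasSubst.of_constantCoeff_zero' (U.constantCoeff_formalMul n)), map_formalNeg, map_formalMul]

/-- **`[−n] = i_U([n] X)` is an endomorphism of `F_U` for EVERY Weierstrass equation over EVERY commutative ring**: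
`[−n](F_U(X, Y)) = F_U([−n] X, [−n] Y)` — over `ℚ[aᵢ]` by logarithms (part I), then `ℤ[aᵢ] ↪ ℚ[aᵢ]`, then specialise.
[cite: SilvermanAEC2009, IV.2.3] -/
theorem formalNeg_subst_formalMul_subst_formalGroupLaw' (n : ℕ) :
    PowerSeries.subst U.formalGroupLaw (U.formalNeg.subst (U.formalMul n)) =
      MvPowerSeries.subst (fun i : Fin 2 ↦ PowerSeries.subst (MvPowerSeries.X i : MvPowerSeries (Fin 2) R)
        (U.formalNeg.subst (U.formalMul n))) U.formalGroupLaw := by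
  -- over `ℚ[aᵢ]`
  have hQ := formalNeg_subst_formalMul_subst_formalGroupLaw_rat
    (universalInt.map (MvPolynomial.map (Int.castRingHom ℚ))) n
  -- over `ℤ[aᵢ]`
  have hZ : PowerSeries.subst universalInt.formalGroupLaw (universalInt.formalNeg.subst (universalInt.formalMul n)) =
      MvPowerSeries.subst (fun i : Fin 2 ↦ PowerSeries.subst
        (MvPowerSeries.X i : MvPowerSeries (Fin 2) (MvPolynomial (Fin 5) ℤ))
        (universalInt.formalNeg.subst (universalInt.formalMul n))) universalInt.formalGroupLaw := by
    apply WeierstrassCurve.mvPowerSeries_map_injective mvPolynomial_map_int_rat_injective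
    rw [map_subst_formalGroupLaw_left _ _ (constantCoeff_formalNeg_subst_formalMul' _ n),
      map_subst_formalGroupLaw_right _ _ (constantCoeff_formalNeg_subst_formalMul' _ n), map_formalNeg_subst_formalMul']
    exact hQ
  -- over `R`
  have hR := congrArg (MvPowerSeries.map U.universalEval) hZ
  rwa [map_subst_formalGroupLaw_left _ _ (constantCoeff_formalNeg_subst_formalMul' _ n),
    map_subst_formalGroupLaw_right _ _ (constantCoeff_formalNeg_subst_formalMul' _ n), map_formalNeg_subst_formalMul',
    universalInt_map] at hR

/-- **`[m] ∘ [−n] = [−n] ∘ [m]` over every commutative ring.** [cite: SilvermanAEC2009, IV.2.3] -/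
theorem formalMul_subst_formalNeg_subst_formalMul' (m n : ℕ) :
    (U.formalMul m).subst (U.formalNeg.subst (U.formalMul n)) =
      PowerSeries.subst (U.formalMul m) (U.formalNeg.subst (U.formalMul n)) := by
  have hQ := formalMul_subst_formalNeg_subst_formalMul_rat (universalInt.map (MvPolynomial.map (Int.castRingHom ℚ))) m n
  have hZ : (universalInt.formalMul m).subst (universalInt.formalNeg.subst (universalInt.formalMul n)) =
      PowerSeries.subst (universalInt.formalMul m) (universalInt.formalNeg.subst (universalInt.formalMul n)) := by
    apply WeierstrassCurve.mvPowerSeries_map_injective (σ := Unit) mvPolynomial_map_int_rat_injective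
    change PowerSeries.map _ _ = PowerSeries.map _ _
    rw [powerSeries_map_subst _ (HasSubst.of_constantCoeff_zero' (constantCoeff_formalNeg_subst_formalMul' _ n)),
      powerSeries_map_subst _ (hasSubst_formalMul _ m), map_formalNeg_subst_formalMul', map_formalMul]
    exact hQ
  have hR := congrArg (PowerSeries.map U.universalEval) hZ
  rwa [powerSeries_map_subst _ (HasSubst.of_constantCoeff_zero' (constantCoeff_formalNeg_subst_formalMul' _ n)),
    powerSeries_map_subst _ (hasSubst_formalMul _ m), map_formalNeg_subst_formalMul', map_formalMul, universalInt_map] at hR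

/-- **`F_U ≡ X + Y (mod deg 2)` over every commutative ring** (from `F(0, T) = T` and commutativity). [cite: SilvermanAEC2009, IV.2.1] -/
theorem coeff_single_formalGroupLaw' (i : Fin 2) :
    MvPowerSeries.coeff (Finsupp.single i 1) U.formalGroupLaw = 1 := by
  have h1 : MvPowerSeries.coeff (Finsupp.single (1 : Fin 2) 1) U.formalGroupLaw = 1 := by
    rw [← coeff_subst_zero_X U.formalGroupLaw 1, U.formalGroupLaw_subst_zero_X, coeff_one_X]
  fin_cases i
  · -- use `F(Y, X) = F(X, Y)`
    have hc := congrArg (MvPowerSeries.coeff (Finsupp.single (0 : Fin 2) 1)) U.formalGroupLaw_comm'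
    rw [LubinTate.coeff_single_subst (fun j ↦ by fin_cases j <;> exact MvPowerSeries.constantCoeff_X _),
      Fin.sum_univ_two] at hc
    simp only [Matrix.cons_val_zero, Matrix.cons_val_one, MvPowerSeries.coeff_X,
      Finsupp.single_eq_single_iff] at hc
    simpa [h1] using hc.symm
  · exact h1

end AnyRing

/-! ## §2 A model over an arbitrary Lubin–Tate base `A` with `i([p] X) ≡ X^{p²} (mod p)` -/

section Base

variable {p : ℕ} {A : Type*} [CommRing A] (U : WeierstrassCurve A) (hA : LubinTate.IsLTRing (-(p : A)) (p ^ 2))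
  (hU : ∀ n : ℕ, (p : A) ∣ coeff n (U.formalNeg.subst (U.formalMul p)) - (if n = p ^ 2 then 1 else 0))

include hU in
/-- **`f_U ∈ 𝔉_{−p}` (`q = p²`)** for every model `U/A` with `f_U = i([p] X) ≡ X^{p²} (mod p)`. [cite: LubinTate1965, §1] -/
theorem isLTSeries_of_dvd : LubinTate.IsLTSeries (-(p : A)) (p ^ 2) (U.formalNeg.subst (U.formalMul p)) := by
  refine ⟨constantCoeff_subst_eq_zero (U.constantCoeff_formalMul p) _ U.constantCoeff_formalNeg, ?_, fun n ↦ neg_dvd.mpr (hU n)⟩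
  rw [coeff_one_subst_eq_mul _ (U.constantCoeff_formalMul p), coeff_one_formalNeg, U.coeff_one_formalMul', neg_one_mul]

/-- **`F_U = F_{f_U}`, Lubin–Tate's formal group of `f_U`**, for every model `U` over a Lubin–Tate base `A` for `(−p, p²)` whose
`i([p] X)` reduces to `X^{p²}` — e.g. a CM curve over `𝒪_{ℚ₄}` with `ψ(w) = −2`. [cite: LubinTate1965, §1 Thm. 1]
[cite: deShalit1987, Ch. II §1] -/
theorem formalGroupLaw_eq_ltF' : U.formalGroupLaw = LubinTate.ltF hA (isLTSeries_of_dvd U hU) := by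
  refine LubinTate.eq_limit hA _ _ U.constantCoeff_formalGroupLaw (coeff_single_formalGroupLaw' U) ?_
  unfold LubinTate.compLeft LubinTate.compRight
  exact formalNeg_subst_formalMul_subst_formalGroupLaw' U p

/-- **`[a]_U ∈ End(F_U)`**: `F_U([a] X, [a] Y) = [a](F_U(X, Y))`, `[a]_U := LubinTate.hom hA hf hf a`. [cite: LubinTate1965, §1 Thm. 1 (8)] -/
theorem formalGroupLaw_subst_hom' (a : A) :
    MvPowerSeries.subst ![LubinTate.homX hA (isLTSeries_of_dvd U hU) (isLTSeries_of_dvd U hU) a (0 : Fin 2),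
        LubinTate.homX hA (isLTSeries_of_dvd U hU) (isLTSeries_of_dvd U hU) a 1] U.formalGroupLaw =
      PowerSeries.subst U.formalGroupLaw (LubinTate.hom hA (isLTSeries_of_dvd U hU) (isLTSeries_of_dvd U hU) a) := by
  rw [formalGroupLaw_eq_ltF' U hA hU]
  exact LubinTate.ltF_subst_homX hA _ _ a

/-- **`[a + b]_U = F_U([a]_U, [b]_U)`.** [cite: LubinTate1965, §1 Thm. 1 (10)] -/
theorem hom_add_eq' (a b : A) :
    LubinTate.hom hA (isLTSeries_of_dvd U hU) (isLTSeries_of_dvd U hU) (a + b) =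
      MvPowerSeries.subst ![LubinTate.hom hA (isLTSeries_of_dvd U hU) (isLTSeries_of_dvd U hU) a,
        LubinTate.hom hA (isLTSeries_of_dvd U hU) (isLTSeries_of_dvd U hU) b] U.formalGroupLaw := by
  rw [formalGroupLaw_eq_ltF' U hA hU]
  exact LubinTate.hom_add hA _ _ a b

/-- **`[n]_U = U.formalMul n`**: the `A`-module structure extends `Ê`'s multiplication maps. [cite: LubinTate1965, §1 Lemma 1] -/
theorem formalMul_eq_hom' (n : ℕ) :
    U.formalMul n = LubinTate.hom hA (isLTSeries_of_dvd U hU) (isLTSeries_of_dvd U hU) (n : A) :=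
  LubinTate.eq_hom hA _ _ (U.constantCoeff_formalMul n) (U.coeff_one_formalMul' n)
    (formalMul_subst_formalNeg_subst_formalMul' U n p).symm

variable (U' : WeierstrassCurve A)
  (hU' : ∀ n : ℕ, (p : A) ∣ coeff n (U'.formalNeg.subst (U'.formalMul p)) - (if n = p ^ 2 then 1 else 0))

/-- **Comparison of two models over `A`**: `[1]_{f_{U'}, f_U}` is a homomorphism `F_U → F_{U'}` (`≡ X`, `A`-linear and invertible by
part II's `compHom_subst_hom`) — e.g. `Ŵ ⊗ ℤ₄ ≅ B̂_w` for a habitat curve `W` and its CM partner `B` at `w ∣ 2`.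
[cite: LubinTate1965, §1 Thm. 1 (8)] [cite: Kobayashi2003, Prop. 8.6] -/
theorem formalGroupLaw_subst_compHom' :
    MvPowerSeries.subst ![LubinTate.homX hA (isLTSeries_of_dvd U' hU') (isLTSeries_of_dvd U hU) 1 (0 : Fin 2),
        LubinTate.homX hA (isLTSeries_of_dvd U' hU') (isLTSeries_of_dvd U hU) 1 1] U'.formalGroupLaw =
      PowerSeries.subst U.formalGroupLaw
        (LubinTate.hom hA (isLTSeries_of_dvd U' hU') (isLTSeries_of_dvd U hU) 1) := by
  rw [formalGroupLaw_eq_ltF' U hA hU, formalGroupLaw_eq_ltF' U' hA hU']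
  exact LubinTate.ltF_subst_homX hA _ _ 1

end Base

/-! ## §3 Consistency with parts I–II: the base change `V ⊗ A` of a `ℤ_p`-model satisfies the congruence hypothesis -/

section Consistency

variable {p : ℕ} [hp : Fact p.Prime] (V : WeierstrassCurve ℤ_[p]) [hE : (V.map PadicInt.Coe.ringHom).IsElliptic]
  [hEt : (V.map PadicInt.toZMod).IsElliptic] {A : Type*} [CommRing A] [Algebra ℤ_[p] A]

/-- For `V/ℤ_p` with elliptic fibres and `tr(V mod p) = 0`, the model `V ⊗ A` satisfies `p ∣ [Xⁿ] i([p]X) − δ_{n,p²}` — the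
hypothesis `hU` of §2 (from part I's `isLTSeries_map_formalNeg_subst_formalMul`). [cite: Kobayashi2003, Prop. 8.6] -/
theorem dvd_coeff_map_of_padicInt
    (htr : Literature.NumberTheory.EllipticCurves.HasseManin.tr (V.map PadicInt.toZMod) = 0) (n : ℕ) :
    (p : A) ∣ coeff n ((V.map (algebraMap ℤ_[p] A)).formalNeg.subst ((V.map (algebraMap ℤ_[p] A)).formalMul p)) -
      (if n = p ^ 2 then 1 else 0) := by
  have h := (isLTSeries_map_formalNeg_subst_formalMul V htr (A := A)).dvd_coeff_sub n
  rw [map_algebraMap_formalNeg_subst_formalMul] at h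
  exact neg_dvd.mp h

end Consistency

end Summit.BirchSwinnertonDyer.BirchSwinnertonDyer.Theorems.RelativeLubinTate

end
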